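import Literature.Analysis.Calculus.LogCutoff
import Literature.Analysis.Calculus.SmoothPlateauProfile
import HarnessLib

/-!
# Route `CylinderEntropy`, item `ImmortalAreaToFloor` (stmt-SmoothPoincare4-17197):
# the height cutoff of the stacking argument (module Γ5' of `BLUEPRINT-17197-c2.md`)

A one-parameter family of `C²` (indeed `C^∞`) height cutoffs by rescaling Mathlib's
`Real.smoothTransition`: for a level `a` and a gap `g > 0`, `u(t) = S(3(a - t)/g)` is `1` below
`a - g/3`, `0` above `a`, takes values in `[0,1]`, and `|u'| ≤ c₁/g`, `|u''| ≤ c₂/g²` with constants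
`c₁, c₂` INDEPENDENT of `a` and `g` (the sup norms of `S'`, `S''` times `3`, `9`).  In the stacking
argument (`BLUEPRINT-17197-c2.md`, Γ6) `a = z₂ - g/3` for two good points at heights `z₁ < z₂ = z₁ + g`:
`u = 1` on `|t - z₁| < g/3` and `1 - u = 1` on `|t - z₂| < g/3`.

* `exists_heightCutoff` — the family with its six properties.
* `one_sub_heightCutoff` — the complementary cutoff `1 - u` has the same derivative bounds.

References: W. K. Allard, Ann. of Math. 95 (1972) §6 (cutoffs in the monotonicity formula);
K. Ecker, *Regularity Theory for Mean Curvature Flow* (2004), proof of Prop. 3.17.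
-/

-- the prescribed namespace `Summit.SmoothPoincare4.SmoothPoincare4.…` repeats `SmoothPoincare4`
set_option linter.dupNamespace false

noncomputable section

open Set Real
open scoped ContDiff Topology

namespace Summit.SmoothPoincare4.SmoothPoincare4.Cruxes.CylinderRungTwo.KillingFlux

open Literature.Analysis.Calculus

/-- **The height cutoffs of the stacking argument.**  There are constants `c₁, c₂ > 0` such that for
every level `a` and gap `g > 0` there is `u ∈ C²(ℝ)` with `0 ≤ u ≤ 1`, `|u'| ≤ c₁/g`, `|u''| ≤ c₂/g²`,
`u = 1` on `(-∞, a - g/3]` and `u = 0` on `[a, ∞)`; namely `u(t) = S(3(a-t)/g)` with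
`S = Real.smoothTransition`, `c₁ = 3(C+1)`, `c₂ = 9(C+1)`, `C` a common bound of `|S'|`, `|S''|`.
[cite: Allard1972, §6] -/
theorem exists_heightCutoff : ∃ c₁ c₂ : ℝ, 0 < c₁ ∧ 0 < c₂ ∧ ∀ a g : ℝ, 0 < g →
    ∃ u : ℝ → ℝ, ContDiff ℝ 2 u ∧ (∀ t, 0 ≤ u t ∧ u t ≤ 1) ∧ (∀ t, |deriv u t| ≤ c₁ / g) ∧
      (∀ t, |deriv (deriv u) t| ≤ c₂ / g ^ 2) ∧ (∀ t, t ≤ a - g / 3 → u t = 1) ∧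
      (∀ t, a ≤ t → u t = 0) := by
  obtain ⟨C, hC0, hC1, hC2⟩ := exists_abs_deriv_and_deriv_deriv_smoothTransition_le
  refine ⟨3 * (C + 1), 9 * (C + 1), by positivity, by positivity, fun a g hg => ?_⟩
  set η : ℝ := g / 3 with hη
  have hη0 : 0 < η := by positivity
  set u : ℝ → ℝ := fun t => smoothTransition ((a - t) / η) with hu
  have hS : ContDiff ℝ ∞ smoothTransition := smoothTransition.contDiff
  have hS' : ContDiff ℝ ∞ (deriv smoothTransition) := hS.iterate_deriv 1
  -- first derivative
  have hd1 : deriv u = fun t => -η⁻¹ * deriv smoothTransition ((a - t) / η) :=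
    deriv_comp_affine_right hS a η
  -- second derivative
  have hd2 : deriv (deriv u) = fun t => η⁻¹ ^ 2 * deriv (deriv smoothTransition) ((a - t) / η) := by
    rw [hd1]
    funext t
    have h1 : deriv (fun t => -η⁻¹ * deriv smoothTransition ((a - t) / η)) t =
        -η⁻¹ * deriv (fun t => deriv smoothTransition ((a - t) / η)) t := by
      apply deriv_const_mul
      have hc : DifferentiableAt ℝ (fun t : ℝ => (a - t) / η) t :=
        ((differentiableAt_id.const_sub a).div_const η)
      exact ((hS'.differentiable (by simp)) _).comp t hc
    rw [h1, deriv_comp_affine_right hS' a η]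
    ring
  refine ⟨u, ?_, ?_, ?_, ?_, ?_, ?_⟩
  · exact (hS.of_le (by norm_cast)).comp ((contDiff_const.sub contDiff_id).div_const η)
  · exact fun t => ⟨smoothTransition.nonneg _, smoothTransition.le_one _⟩
  · intro t
    rw [hd1]
    have hinv : η⁻¹ = 3 / g := by rw [hη]; field_simp
    calc |-η⁻¹ * deriv smoothTransition ((a - t) / η)|
        = η⁻¹ * |deriv smoothTransition ((a - t) / η)| := by
          rw [abs_mul, abs_neg, abs_of_pos (inv_pos.2 hη0)]
      _ ≤ η⁻¹ * C := mul_le_mul_of_nonneg_left (hC1 _) (inv_pos.2 hη0).le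
      _ ≤ η⁻¹ * (C + 1) := mul_le_mul_of_nonneg_left (by linarith) (inv_pos.2 hη0).le
      _ = 3 * (C + 1) / g := by rw [hinv]; ring
  · intro t
    rw [hd2]
    have hinv : η⁻¹ ^ 2 = 9 / g ^ 2 := by rw [hη]; field_simp; ring
    calc |η⁻¹ ^ 2 * deriv (deriv smoothTransition) ((a - t) / η)|
        = η⁻¹ ^ 2 * |deriv (deriv smoothTransition) ((a - t) / η)| := by
          rw [abs_mul, abs_of_pos (by positivity)]
      _ ≤ η⁻¹ ^ 2 * C := mul_le_mul_of_nonneg_left (hC2 _) (by positivity)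
      _ ≤ η⁻¹ ^ 2 * (C + 1) := mul_le_mul_of_nonneg_left (by linarith) (by positivity)
      _ = 9 * (C + 1) / g ^ 2 := by rw [hinv]; ring
  · intro t ht
    refine smoothTransition.one_of_one_le ?_
    rw [le_div_iff₀ hη0, one_mul, hη]
    linarith
  · intro t ht
    refine smoothTransition.zero_of_nonpos ?_
    exact div_nonpos_of_nonpos_of_nonneg (by linarith) hη0.le

/-- **The complementary cutoff.**  If `u ∈ C²` with `0 ≤ u ≤ 1`, `|u'| ≤ c₁/g`, `|u''| ≤ c₂/g²`, then
`v = 1 - u` is `C²` with `0 ≤ v ≤ 1`, `|v'| ≤ c₁/g`, `|v''| ≤ c₂/g²` (`v' = -u'`, `v'' = -u''`).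
[folklore] -/
theorem one_sub_heightCutoff {u : ℝ → ℝ} {c₁ c₂ g : ℝ} (hu : ContDiff ℝ 2 u)
    (hu01 : ∀ t, 0 ≤ u t ∧ u t ≤ 1) (hu1 : ∀ t, |deriv u t| ≤ c₁ / g)
    (hu2 : ∀ t, |deriv (deriv u) t| ≤ c₂ / g ^ 2) :
    ContDiff ℝ 2 (fun t => 1 - u t) ∧ (∀ t, 0 ≤ 1 - u t ∧ 1 - u t ≤ 1) ∧
      (∀ t, |deriv (fun t => 1 - u t) t| ≤ c₁ / g) ∧
      (∀ t, |deriv (deriv fun t => 1 - u t) t| ≤ c₂ / g ^ 2) := by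
  have hud : Differentiable ℝ u := hu.differentiable (by norm_num)
  have hd1 : deriv (fun t => 1 - u t) = fun t => -deriv u t := by
    funext t
    rw [deriv_const_sub]
  have hu' : ContDiff ℝ 1 (deriv u) := hu.deriv'
  have hud' : Differentiable ℝ (deriv u) := hu'.differentiable one_ne_zero
  have hd2 : deriv (deriv fun t => 1 - u t) = fun t => -deriv (deriv u) t := by
    rw [hd1]
    funext t
    exact deriv.neg
  refine ⟨contDiff_const.sub hu, fun t => ⟨by linarith [(hu01 t).2], by linarith [(hu01 t).1]⟩,
    fun t => ?_, fun t => ?_⟩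
  · rw [hd1, abs_neg]; exact hu1 t
  · rw [hd2, abs_neg]; exact hu2 t

end Summit.SmoothPoincare4.SmoothPoincare4.Cruxes.CylinderRungTwo.KillingFlux

end
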